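import Summits.CriticalPhenomena.SAWScalingLimit.Theses.SAWTotalPositivity
import Summits.CriticalPhenomena.SAWScalingLimit.Theorems.CriticalBubbleBound.Negative.CriticalBubbleBoundOneNumber

/-!
# Negative-side file for the crux `SAWTotalPositivity.TPToTraversalBound` (stmt-CriticalPhenomena-10687):
POSITIVE AUDIT — what hypothesis (B) buys at lattice scale: the sketch lemma `BubbleTailDive` (ideator 2) holds

Refuter `cdisprove` (standing adversary, cycle 3); work file
`Summits/CriticalPhenomena/SAWScalingLimit/Cruxes/TPToTraversalBound/Disproof.lean` §8.
`bubbleTailDive` has verbatim the hypothesis/binders/conclusion of `Sketch.BubbleTailDive`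
(`Cruxes/TPToTraversalBound/SketchIdeator2.lean`): from `CriticalBubbleBound` alone (through its one-number normal form `criticalBubbleBound_iff_bubble_ne_top`,
landed by the cdisprove seat of stmt-CriticalPhenomena-7117), between ADJACENT points `u ∼ v` of any `Ω_δ` the
critical chord reaches Euclidean distance `≥ C δ` with probability `≤ ε` once `C = C(ε)`, uniformly in
`(Ω, δ, u, v)`: far excursions force long walks (`dist ≤ 2δ|γ|`), long walks are the tail of the finite lattice
bubble `G_{x_c}(0,e)` by hypothesis-free domain monotonicity and translation invariance, and `Z_Ω(u,v) ≥ x_c`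
(the edge is a SAW).  This is ALL that (B) gives a line (nothing mesoscopic — work file F4): the lattice-scale
seed, certified.
-/

namespace Summit.CriticalPhenomena.SAWScalingLimit.Theorems.TPToTraversalBound.Negative

open scoped BigOperators ENNReal Topology
open MeasureTheory Filter Set Function Literature.Probability.LatticeModels
open Literature.Probability.RandomPlanarGeometry Literature.Probability.RandomPlanarGeometry.SAW
open Literature.Barriers.CriticalPhenomena.SupercriticalSAW
open Summit.CriticalPhenomena.SAWScalingLimit.Theorems.CriticalBubbleBound.Negative
open Summit.CriticalPhenomena.SAWScalingLimit.Theses.SAWTotalPositivity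


/-- The LENGTH-TAIL of the critical lattice kernel: `Σ_{γ : u → v SAW of ℤ², |γ| ≥ L} x_c^{|γ|}`. -/
noncomputable def tailKernel (L : ℕ) (u v : Site 2) : ℝ≥0∞ :=
  ∑' p : LatticeSAW u v, if L ≤ p.1.length then ENNReal.ofReal (criticalFugacity ^ p.1.length) else 0

/-- The tail is antitone in the cut-off. [folklore] -/
theorem tailKernel_antitone {L L' : ℕ} (h : L ≤ L') (u v : Site 2) : tailKernel L' u v ≤ tailKernel L u v := by
  refine ENNReal.tsum_le_tsum fun p => ?_
  by_cases hp : L' ≤ p.1.length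
  · rw [if_pos hp, if_pos (h.trans hp)]
  · rw [if_neg hp]; exact zero_le

/-- The tail does not decrease under translating both endpoints. [folklore] -/
theorem tailKernel_le_shift (L : ℕ) (u v c : Site 2) : tailKernel L u v ≤ tailKernel L (u + c) (v + c) := by
  let F : LatticeSAW u v → LatticeSAW (u + c) (v + c) := fun p =>
    ⟨p.1.map (shiftIso c).toHom, p.2.map (shiftIso c).injective⟩
  have hF : Injective F := by
    rintro ⟨p, hp⟩ ⟨q, hq⟩ h
    have h' := congrArg Subtype.val h
    exact Subtype.ext (SimpleGraph.Walk.map_injective_of_injective (shiftIso c).injective u v h')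
  have hlen : ∀ p : LatticeSAW u v, (F p).1.length = p.1.length := fun p => SimpleGraph.Walk.length_map _ _
  have key : (fun p : LatticeSAW u v => if L ≤ p.1.length then ENNReal.ofReal (criticalFugacity ^ p.1.length) else 0) =
      fun p => (fun q : LatticeSAW (u + c) (v + c) =>
        if L ≤ q.1.length then ENNReal.ofReal (criticalFugacity ^ q.1.length) else 0) (F p) := by
    funext p; simp only [hlen]
  calc tailKernel L u v
      = ∑' p : LatticeSAW u v, (fun q : LatticeSAW (u + c) (v + c) =>
          if L ≤ q.1.length then ENNReal.ofReal (criticalFugacity ^ q.1.length) else 0) (F p) := by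
        rw [tailKernel, key]
    _ ≤ tailKernel L (u + c) (v + c) := ENNReal.tsum_comp_le_tsum_of_injective hF _

/-- Reduction to the origin: `tail(u,v) ≤ tail(0, v - u)`. [folklore] -/
theorem tailKernel_le_zero_sub (L : ℕ) (u v : Site 2) : tailKernel L u v ≤ tailKernel L 0 (v - u) := by
  have h := tailKernel_le_shift L u v (-u)
  rwa [add_neg_cancel, ← sub_eq_add_neg] at h

/-- Vanishing tails: if the bubble `G_{x_c}(0,e)` is finite, the length-tail at `e` is eventually `≤ ε`.
[folklore] -/
theorem exists_tailKernel_le {e : Site 2} (he : bubble e ≠ ⊤) {ε : ℝ≥0∞} (hε : ε ≠ 0) :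
    ∃ L : ℕ, tailKernel L 0 e ≤ ε := by
  classical
  set f : LatticeSAW 0 e → ℝ≥0∞ := fun p => ENNReal.ofReal (criticalFugacity ^ p.1.length) with hf
  have hsum : ∑' p, f p ≠ ⊤ := he
  have ht := ENNReal.tendsto_tsum_compl_atTop_zero hsum
  have hev : ∀ᶠ s : Finset (LatticeSAW 0 e) in atTop, (∑' a : {x // x ∉ s}, f a) < ε :=
    (tendsto_order.1 ht).2 ε (pos_iff_ne_zero.2 hε)
  obtain ⟨s, hs⟩ := hev.exists
  have heq : ∑' x, ((↑s : Set (LatticeSAW 0 e))ᶜ).indicator f x = ∑' a : {x // x ∉ s}, f a :=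
    (tsum_subtype ((↑s : Set (LatticeSAW 0 e))ᶜ) f).symm
  refine ⟨s.sup (fun p => p.1.length) + 1, le_of_lt (lt_of_le_of_lt ?_ (heq ▸ hs))⟩
  rw [tailKernel]
  refine ENNReal.tsum_le_tsum fun p => ?_
  by_cases hp : s.sup (fun p => p.1.length) + 1 ≤ p.1.length
  · have hps : p ∈ ((↑s : Set (LatticeSAW 0 e))ᶜ) := by
      intro hps
      have := Finset.le_sup (f := fun p : LatticeSAW 0 e => p.1.length) (Finset.mem_coe.1 hps)
      omega
    rw [if_pos hp, Set.indicator_of_mem hps]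
  · rw [if_neg hp]; exact zero_le

/-- Mesh-point distances are dominated by lattice walk lengths: every vertex of a SAW of `Ω_δ` from `u` is
within Euclidean distance `2 δ |γ|` of the start (for `δ ≥ 0`). [folklore] -/
theorem dist_meshPoint_le_length {Ω : Set ℂ} {δ : ℝ} (hδ : 0 ≤ δ) {u v : Site 2}
    (γ : DomainSAW Ω δ u v) {z : Site 2} (hz : z ∈ γ.walk.support) :
    dist (meshPoint δ z) (meshPoint δ u) ≤ 2 * δ * γ.length := by
  have hsup : z ∈ (toLattice γ).1.support := by rw [support_toLattice]; exact hz
  have hb := abs_sub_le_length (toLattice γ).1 z hsup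
  have h0 : |((z 0 : ℤ) : ℝ) - u 0| ≤ γ.length := by
    have := hb 0; rw [length_toLattice] at this; exact_mod_cast this
  have h1 : |((z 1 : ℤ) : ℝ) - u 1| ≤ γ.length := by
    have := hb 1; rw [length_toLattice] at this; exact_mod_cast this
  rw [dist_eq_norm]
  have hre : (meshPoint δ z - meshPoint δ u).re = δ * ((z 0 : ℝ) - u 0) := by
    rw [Complex.sub_re, meshPoint_re, meshPoint_re]; ring
  have him : (meshPoint δ z - meshPoint δ u).im = δ * ((z 1 : ℝ) - u 1) := by
    rw [Complex.sub_im, meshPoint_im, meshPoint_im]; ring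
  calc ‖meshPoint δ z - meshPoint δ u‖
      ≤ |(meshPoint δ z - meshPoint δ u).re| + |(meshPoint δ z - meshPoint δ u).im| :=
        Complex.norm_le_abs_re_add_abs_im _
    _ = δ * |((z 0 : ℤ) : ℝ) - u 0| + δ * |((z 1 : ℤ) : ℝ) - u 1| := by
        rw [hre, him, abs_mul, abs_mul, abs_of_nonneg hδ]
    _ ≤ δ * γ.length + δ * γ.length := by gcongr
    _ = 2 * δ * γ.length := by ring

/-- The far-excursion event is dominated by the length-tail of the lattice kernel: with cut-off `C = 2L`,
`weight {γ reaches distance ≥ C δ} ≤ tail_L(u,v)` for every `Ω` and every `δ > 0`. [folklore] -/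
theorem weight_far_le_tailKernel (Ω : Set ℂ) {δ : ℝ} (hδ : 0 < δ) (u v : Site 2) (L : ℕ) :
    SAW.weight Ω δ u v {γ | ∃ z ∈ γ.walk.support, ((2 * L : ℕ) : ℝ) * δ ≤ dist (meshPoint δ z) (meshPoint δ u)}
      ≤ tailKernel L u v := by
  set E : Set (DomainSAW Ω δ u v) :=
    {γ | ∃ z ∈ γ.walk.support, ((2 * L : ℕ) : ℝ) * δ ≤ dist (meshPoint δ z) (meshPoint δ u)} with hE
  have hlen : ∀ γ ∈ E, L ≤ γ.length := by
    rintro γ ⟨z, hz, hfar⟩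
    have h := hfar.trans (dist_meshPoint_le_length hδ.le γ hz)
    have h' : ((2 * L : ℕ) : ℝ) ≤ 2 * (γ.length : ℝ) := by
      have : ((2 * L : ℕ) : ℝ) * δ ≤ (2 * (γ.length : ℝ)) * δ := by nlinarith
      exact le_of_mul_le_mul_right this hδ
    have : (2 * L : ℕ) ≤ 2 * γ.length := by exact_mod_cast h'
    omega
  let g : LatticeSAW u v → ℝ≥0∞ := fun p =>
    if L ≤ p.1.length then ENNReal.ofReal (criticalFugacity ^ p.1.length) else 0
  calc SAW.weight Ω δ u v E
      = ∑' γ, E.indicator (fun γ => ENNReal.ofReal (criticalFugacity ^ γ.length)) γ := by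
        rw [← weightAt_criticalFugacity, weightAt_apply]
    _ ≤ ∑' γ : DomainSAW Ω δ u v, g (toLattice γ) := by
        refine ENNReal.tsum_le_tsum fun γ => ?_
        by_cases hγ : γ ∈ E
        · rw [Set.indicator_of_mem hγ]
          simp only [g, length_toLattice, if_pos (hlen γ hγ)]; exact le_rfl
        · rw [Set.indicator_of_notMem hγ]; exact zero_le
    _ ≤ ∑' p : LatticeSAW u v, g p := ENNReal.tsum_comp_le_tsum_of_injective toLattice_injective _
    _ = tailKernel L u v := rfl

/-- CERTIFIED (positive audit of a sketch lemma): `Sketch.BubbleTailDive` (ideator 2; its hypothesis, binders and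
conclusion are reproduced VERBATIM here, so `fun hB ε hε => bubbleTailDive hB ε hε` inhabits the sketch `Prop`) holds.
From the crux's
hypothesis (B) (in its one-number normal form `criticalBubbleBound_iff_bubble_ne_top`, landed by the cdisprove
seat of stmt-7117): far excursions force long walks (`dist ≤ 2δ|γ|`), long walks are the tail of the finite
lattice bubble `G_{x_c}(0,e)` uniformly in `(Ω, δ)` by hypothesis-free domain monotonicity and translation
invariance, and the law is the weight divided by `Z_Ω(u,v) ≥ x_c` (the edge `u ∼ v` of `Ω_δ` is a SAW).  No
junk: the only degenerate inputs (`u ∼ v` not joined, `δ ≤ 0`, unbounded `Ω`) are excluded or harmless.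
[folklore] -/
theorem bubbleTailDive (hB : Theses.SAWTotalPositivity.CriticalBubbleBound) (ε : ℝ) (hε : 0 < ε) :
    ∃ C : ℕ, ∀ (Ω : Set ℂ) (δ : ℝ) (u v : Site 2), Bornology.IsBounded Ω → 0 < δ →
      (discreteDomainGraph Ω δ).Adj u v →
      SAW.law Ω δ u v {γ | ∃ z ∈ γ.walk.support, (C : ℝ) * δ ≤ dist (meshPoint δ z) (meshPoint δ u)}
        ≤ ENNReal.ofReal ε := by
  rw [criticalBubbleBound_iff_bubble_ne_top] at hB
  have hxc : 0 < criticalFugacity := SAW.criticalFugacity_pos_lt_one'.1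
  set ε' : ℝ≥0∞ := ENNReal.ofReal ε * ENNReal.ofReal criticalFugacity with hε'
  have hε'0 : ε' ≠ 0 := by
    rw [hε']
    exact mul_ne_zero (by simpa using hε) (by simpa using hxc)
  -- the four unit vectors
  have adj_pos : ∀ i : Fin 2, (zdGraph 2).Adj 0 (Pi.single i 1) := fun i =>
    (zdGraph_adj_iff _ _).2 ⟨i, Or.inl (zero_add _).symm⟩
  have adj_neg : ∀ i : Fin 2, (zdGraph 2).Adj 0 (-Pi.single i 1) := fun i =>
    (zdGraph_adj_iff _ _).2 ⟨i, Or.inr (neg_add_cancel _).symm⟩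
  obtain ⟨L₁, hL₁⟩ := exists_tailKernel_le (hB _ (adj_pos 0)) hε'0
  obtain ⟨L₂, hL₂⟩ := exists_tailKernel_le (hB _ (adj_pos 1)) hε'0
  obtain ⟨L₃, hL₃⟩ := exists_tailKernel_le (hB _ (adj_neg 0)) hε'0
  obtain ⟨L₄, hL₄⟩ := exists_tailKernel_le (hB _ (adj_neg 1)) hε'0
  set L : ℕ := max (max L₁ L₂) (max L₃ L₄) with hL
  have hLe : ∀ e : Site 2, (zdGraph 2).Adj 0 e → tailKernel L 0 e ≤ ε' := by
    intro e he
    obtain ⟨i, hi | hi⟩ := (zdGraph_adj_iff _ _).1 he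
    · rw [zero_add] at hi
      subst hi
      fin_cases i
      · exact (tailKernel_antitone (by omega) _ _).trans hL₁
      · exact (tailKernel_antitone (by omega) _ _).trans hL₂
    · have : e = -Pi.single i 1 := eq_neg_of_add_eq_zero_left hi.symm
      subst this
      fin_cases i
      · exact (tailKernel_antitone (by omega) _ _).trans hL₃
      · exact (tailKernel_antitone (by omega) _ _).trans hL₄
  refine ⟨2 * L, fun Ω δ u v _ hδ huv => ?_⟩
  have hzd : (zdGraph 2).Adj u v := discreteDomainGraph_le_zdGraph Ω δ huv
  have he : (zdGraph 2).Adj 0 (v - u) := by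
    have := (Zd.zdGraph_adj_sub_right u v u).2 hzd
    rwa [sub_self] at this
  -- the edge SAW gives `Z_Ω(u,v) ≥ x_c`
  have hZ : ENNReal.ofReal criticalFugacity ≤ SAW.weight Ω δ u v Set.univ := by
    let γ₁ : DomainSAW Ω δ u v := ⟨SimpleGraph.Walk.cons huv SimpleGraph.Walk.nil, by
      simp [SimpleGraph.Walk.isPath_def, SimpleGraph.Walk.support, huv.ne]⟩
    calc ENNReal.ofReal criticalFugacity = SAW.weight Ω δ u v {γ₁} := by
          rw [weight_singleton]; simp [γ₁, DomainSAW.length]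
      _ ≤ SAW.weight Ω δ u v Set.univ := measure_mono (Set.subset_univ _)
  have hE : SAW.weight Ω δ u v
      {γ | ∃ z ∈ γ.walk.support, ((2 * L : ℕ) : ℝ) * δ ≤ dist (meshPoint δ z) (meshPoint δ u)} ≤ ε' :=
    ((weight_far_le_tailKernel Ω hδ u v L).trans (tailKernel_le_zero_sub L u v)).trans (hLe _ he)
  rw [SAW.law, Measure.smul_apply, smul_eq_mul]
  have hxc' : ENNReal.ofReal criticalFugacity ≠ 0 := by simpa using hxc
  calc (SAW.weight Ω δ u v Set.univ)⁻¹ * SAW.weight Ω δ u v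
        {γ | ∃ z ∈ γ.walk.support, ((2 * L : ℕ) : ℝ) * δ ≤ dist (meshPoint δ z) (meshPoint δ u)}
      ≤ (ENNReal.ofReal criticalFugacity)⁻¹ * ε' := mul_le_mul' (ENNReal.inv_le_inv.2 hZ) hE
    _ = ENNReal.ofReal ε := by
        rw [hε', mul_comm (ENNReal.ofReal ε), ← mul_assoc,
          ENNReal.inv_mul_cancel hxc' ENNReal.ofReal_ne_top, one_mul]


end Summit.CriticalPhenomena.SAWScalingLimit.Theorems.TPToTraversalBound.Negative
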